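import Mathlib
import Summits.KontsevichZagierPeriods.Zeta5Search.BrickPhiCoeff
import Summits.KontsevichZagierPeriods.Zeta5Search.BrickTopKummer

/-!
# BrickDigitStrip — the DIGIT-STRIPPING FACTORISATION (E2): `F_j(pT) = λ_j·F̃_J(T)·U_j(T)` with
`U_j ∈ 1 + pTℤ_(p)⟦T⟧`, for `n = Np + n₀`, `j = Jp + j₀` in the main case (zi-p2 THEOREM 6 Step E⁺ (E2),
PLAN-T7 L7.2 (★), THEOREM 7 LEMMA 2 at `E_j = 1`; cell zeta5-irr)

HONEST FRAMING: systematic search; no irrationality claim unless certified. INSTRUMENT lemma of the ζ(5)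
census cell zeta5-irr (HOME `run/shared/lean/pub/zeta5-irr/`; memo `zi-p2/probes/B8/thm6/THEOREM6.md` Step E⁺
«(b) MAIN CASE: `j_0 ≤ n_0`, `n_0 + j_0 ≤ p−1`, `2n_0 − j_0 ≤ p−1`, `p ∤ (n−2j)` … `F_j(pT) = c_{j,A}(n)·Ĝ_{n_1,j_1}(T)·U(T)`
EXACTLY … (E2)»; `zi-p2/probes/B8/thm7-plan/PLAN-T7.md` L7.2 «`F_j(pT) = λ_j·[T^AR̃_{n′}(−j′+T)]·U_j(T)`,
`U_j(T) = ∏_{p∤x}(1 + pT/x)^{μ} ∈ 1 + pTℤ_(p)[[T]]` (★)»; HOME INBOX 2026-08-27T03:20:27Z zi-p2 g12 (i)). Nothing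
here is about ζ(5); no irrationality content; filing moves no rung. Filed by the engine seat zi-eng (g8).

## The statement

Let `p` be an odd prime, `n = n₀ + N·p`, `j = j₀ + J·p` with `J ≤ N` and ONE-DIGIT MAIN-CASE conditions
`j₀ ≤ n₀`, `n₀ + j₀ < p`, `n₀ + (n₀ − j₀) < p`, and (only if `ε ≥ 1`) `p ∤ n − 2j`. Then the offsets of
`F_j = laurentSeries A B ε n j` that are multiples of `p` are EXACTLY `p`× the offsets of the symmetric
level-`N` kernel `F̃_J = laurentSeries A B 0 N J` (denominators `m = m′p + j₀ ↔ m′`, numerators `j + m = p(J + m″)`,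
`n + m − j = p(N + m″ − J)` ↔ `m″ ∈ [1, N]`), and every other offset `x` is a `p`-adic unit contributing a UNIT FACTOR
`pT + x = x·(1 + (p/x)T)`. Hence (`laurentSeries_rescale_eq`):

**`rescale_p(F_j) = C(λ)·F̃_J·U`** with `U(0) = 1`, `U` of slope `−1` and budget `0` (`[T^g]U ∈ p^gℤ_(p)`,
`ScaledSeries.IsSlopeInt p (−1) 0 U`) and **`λ·c̃_{J,A}(N) = c_{j,A}(n)`** (constant terms), i.e. zi-p2's
`λ_j = c_{j,A}(n)/c̃_{j_1,A}(n_1)`. Reading `[T^d]`: `p^d·c_{j,A−d}(n) = λ_j·Σ_{e+g=d} c̃_{J,A−e}(N)·[T^g]U`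
(`laurent_rescale_eq_sum`). The carry cells (`j₀ > n₀`, `n₀ + j₀ ≥ p`, …; THEOREM 7's `E_j ≠ 1`) are NOT treated here.
-/

namespace Summit.KontsevichZagierPeriods.Zeta5Search.BrickDigitStrip

open Finset Nat Polynomial WithZero
open Summit.KontsevichZagierPeriods.Zeta5Search.BrickLaurent (expandAt laurentSeries laurent cell kerNum kerDenErase
  constantCoeff_coe_taylor coe_comp_C_mul_X rescale_inv eval_kerDenErase_neg_ne_zero)
open Summit.KontsevichZagierPeriods.Zeta5Search.BrickLaurentValuation (taylor_kerNum taylor_kerDenErase lin)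
open Summit.KontsevichZagierPeriods.Zeta5Search.ScaledSeries (IsSlopeInt isSlopeInt_mul isSlopeInt_prod
  isSlopeInt_pow isSlopeInt_one isSlopeInt_lin)
open Summit.KontsevichZagierPeriods.Zeta5Search.BrickPhiCoeff (isSlopeInt_inv)
open Literature.NumberTheory.LFunctions (padicValuation_natCast_eq_one)

noncomputable section

variable {p : ℕ} [Fact p.Prime]

/-! ## Splitting a product along an injection -/

/-- Split `∏_{m ∈ s} f m` into the part parametrised by `g : T → {m ∈ s | P m}` (a bijection) and the rest. -/
theorem prod_split {R : Type*} [CommMonoid R] {s T : Finset ℕ} (g : ℕ → ℕ) (P : ℕ → Prop) [DecidablePred P]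
    (hg : ∀ t ∈ T, g t ∈ s ∧ P (g t)) (hinj : Set.InjOn g T) (hsurj : ∀ m ∈ s, P m → ∃ t ∈ T, g t = m)
    (f : ℕ → R) : ∏ m ∈ s, f m = (∏ t ∈ T, f (g t)) * ∏ m ∈ s.filter (fun m => ¬ P m), f m := by
  have hT : s.filter P = T.image g := by
    ext m
    simp only [mem_filter, mem_image]
    constructor
    · rintro ⟨hm, hP⟩
      obtain ⟨t, ht, rfl⟩ := hsurj m hm hP
      exact ⟨t, ht, rfl⟩
    · rintro ⟨t, ht, rfl⟩
      exact hg t ht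
  rw [← prod_filter_mul_prod_filter_not s P, hT, prod_image hinj]

/-! ## Unit factors `pT + x = x·(1 + (p/x)T)` and unit polynomials -/

/-- `IsUnitPoly p V`: `V(0) = 1` and `[T^g]V ∈ p^gℤ_(p)` for all `g` (slope `−1`, budget `0`). -/
def IsUnitPoly (p : ℕ) [Fact p.Prime] (V : ℚ[X]) : Prop := V.eval 0 = 1 ∧ IsSlopeInt p (-1) 0 (V : PowerSeries ℚ)

/-- `1` is a unit polynomial. -/
theorem isUnitPoly_one : IsUnitPoly p (1 : ℚ[X]) :=
  ⟨eval_one, by rw [Polynomial.coe_one]; exact isSlopeInt_one (-1)⟩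

/-- Unit polynomials are closed under products. -/
theorem IsUnitPoly.mul {V W : ℚ[X]} (hV : IsUnitPoly p V) (hW : IsUnitPoly p W) : IsUnitPoly p (V * W) :=
  ⟨by rw [eval_mul, hV.1, hW.1, mul_one], by rw [Polynomial.coe_mul]; simpa using isSlopeInt_mul hV.2 hW.2⟩

/-- Unit polynomials are closed under powers. -/
theorem IsUnitPoly.pow {V : ℚ[X]} (hV : IsUnitPoly p V) (k : ℕ) : IsUnitPoly p (V ^ k) := by
  induction k with
  | zero => simpa using isUnitPoly_one (p := p)
  | succ k ih => rw [pow_succ]; exact ih.mul hV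

/-- Unit polynomials are closed under finite products. -/
theorem isUnitPoly_prod {s : Finset ℕ} {V : ℕ → ℚ[X]} (h : ∀ m ∈ s, IsUnitPoly p (V m)) :
    IsUnitPoly p (∏ m ∈ s, V m) := by
  classical
  induction s using Finset.induction_on with
  | empty => simpa using isUnitPoly_one (p := p)
  | insert a s ha ih =>
    rw [prod_insert ha]
    exact (h a (mem_insert_self a s)).mul (ih fun m hm => h m (mem_insert_of_mem hm))

omit [Fact p.Prime] in
/-- `pX + x = x·(1 + (p/x)X)` for `x ≠ 0`. -/
theorem C_mul_X_add_C_eq {x : ℚ} (hx : x ≠ 0) :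
    (C (p : ℚ) * X + C x : ℚ[X]) = C x * (1 + C ((p : ℚ) / x) * X) := by
  rw [mul_add, mul_one, ← mul_assoc, ← C_mul, mul_div_cancel₀ _ hx, add_comm]

/-- The UNIT FACTOR `1 + (p/x)T` is a unit polynomial when `x` is a `p`-adic unit. -/
theorem isUnitPoly_factor {x : ℚ} (hx : Rat.padicValuation p x = 1) : IsUnitPoly p (1 + C ((p : ℚ) / x) * X) := by
  have hx0 : x ≠ 0 := fun h => by rw [h, map_zero] at hx; exact zero_ne_one hx
  refine ⟨by simp, ?_⟩
  have e : (((1 + C ((p : ℚ) / x) * X : ℚ[X]) : PowerSeries ℚ)) = lin (x / p) := by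
    rw [BrickLaurentValuation.lin, inv_div, Polynomial.coe_add, Polynomial.coe_one, Polynomial.coe_mul,
      Polynomial.coe_C, Polynomial.coe_X]
  rw [e]
  refine isSlopeInt_lin le_rfl ?_
  rw [inv_div, map_div₀, hx, div_one, Rat.padicValuation_self, add_zero]

/-- A product of factors `pX + x_m` over `p`-adic UNIT offsets `x_m`: `∏(pX + x_m) = C(∏ x_m)·V`, `V` a unit
polynomial, `∏ x_m ≠ 0`. -/
theorem prod_unit_eq {s : Finset ℕ} {x : ℕ → ℚ} (hx : ∀ m ∈ s, Rat.padicValuation p (x m) = 1) :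
    ∃ V : ℚ[X], IsUnitPoly p V ∧ (∏ m ∈ s, x m) ≠ 0 ∧ ∏ m ∈ s, (C (p : ℚ) * X + C (x m)) = C (∏ m ∈ s, x m) * V := by
  have hx0 : ∀ m ∈ s, x m ≠ 0 := fun m hm h => by have := hx m hm; rw [h, map_zero] at this; exact zero_ne_one this
  refine ⟨∏ m ∈ s, (1 + C ((p : ℚ) / x m) * X), isUnitPoly_prod fun m hm => isUnitPoly_factor (hx m hm),
    prod_ne_zero_iff.2 hx0, ?_⟩
  rw [map_prod, ← prod_mul_distrib]
  exact prod_congr rfl fun m hm => C_mul_X_add_C_eq (hx0 m hm)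

omit [Fact p.Prime] in
/-- A product of factors `pX + p·x′_t` over `p`-DIVISIBLE offsets: `∏(pX + p x′_t) = C(p^{|T|})·∏(X + x′_t)`. -/
theorem prod_div_eq (T : Finset ℕ) (x' : ℕ → ℚ) :
    ∏ t ∈ T, (C (p : ℚ) * X + C ((p : ℚ) * x' t)) = C ((p : ℚ) ^ T.card) * ∏ t ∈ T, (X + C (x' t)) := by
  rw [map_pow, ← prod_const, ← prod_mul_distrib]
  exact prod_congr rfl fun t _ => by rw [C_mul, mul_add]

/-! ## The three offset families in the main case -/

/-- A `p`-adic unit integer offset. -/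
theorem padicValuation_intCast_eq_one_of {z : ℤ} (hz : ¬ (p : ℤ) ∣ z) : Rat.padicValuation p (z : ℚ) = 1 := by
  rw [Rat.padicValuation_cast, Int.padicValuation_eq_one_iff]; exact hz

section families

variable {N n₀ J j₀ : ℕ} (hn₀ : n₀ < p) (hj₀ : j₀ ≤ n₀)
include hn₀ hj₀

/-- DENOMINATORS: `∏_{m ≤ n, m ≠ j}(pX + (m − j)) = C(c)·[∏_{m′ ≤ N, m′ ≠ J}(X + (m′ − J))]·V`, `V` unit, `c ≠ 0`
(`m = j₀ + m′p` are the `p`-divisible offsets; needs only `j₀ ≤ n₀ < p`). -/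
theorem den_family (N J : ℕ) :
    ∃ V : ℚ[X], IsUnitPoly p V ∧ ∃ c : ℚ, c ≠ 0 ∧
      ∏ m ∈ (range (n₀ + N * p + 1)).erase (j₀ + J * p), (C (p : ℚ) * X + C ((m : ℚ) - (j₀ + J * p : ℕ))) =
        C c * (∏ m ∈ (range (N + 1)).erase J, (X + C ((m : ℚ) - J))) * V := by
  have hp : p.Prime := Fact.out
  have hp0 : 0 < p := hp.pos
  have hjmod : (j₀ + J * p) % p = j₀ := by rw [Nat.add_mul_mod_self_right, Nat.mod_eq_of_lt (by omega)]
  -- the bijection `t ↦ j₀ + t p` onto the `p`-divisible offsets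
  have hg : ∀ t ∈ (range (N + 1)).erase J,
      j₀ + t * p ∈ (range (n₀ + N * p + 1)).erase (j₀ + J * p) ∧ (j₀ + t * p) % p = j₀ := by
    intro t ht
    have ht' := mem_range.1 (mem_erase.1 ht).2
    have htJ := (mem_erase.1 ht).1
    have h1 : t * p ≤ N * p := Nat.mul_le_mul_right _ (by omega)
    refine ⟨mem_erase.2 ⟨fun h => htJ (Nat.eq_of_mul_eq_mul_right hp0 (by omega)), mem_range.2 (by omega)⟩, ?_⟩
    rw [Nat.add_mul_mod_self_right, Nat.mod_eq_of_lt (by omega)]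
  have hinj : Set.InjOn (fun t => j₀ + t * p) ((range (N + 1)).erase J : Finset ℕ) :=
    fun t₁ _ t₂ _ h => Nat.eq_of_mul_eq_mul_right hp0 (by simpa using h)
  have hsurj : ∀ m ∈ (range (n₀ + N * p + 1)).erase (j₀ + J * p), m % p = j₀ → ∃ t ∈ (range (N + 1)).erase J,
      j₀ + t * p = m := by
    intro m hm hmod
    have hm' := mem_range.1 (mem_erase.1 hm).2
    have hmj := (mem_erase.1 hm).1
    have hdec : j₀ + m / p * p = m := by
      have := Nat.mod_add_div m p; rw [hmod, mul_comm] at this; exact this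
    refine ⟨m / p, mem_erase.2 ⟨fun h => hmj (by rw [← hdec, h]), mem_range.2 ?_⟩, hdec⟩
    by_contra hcon
    have h1 : (N + 1) * p ≤ m / p * p := Nat.mul_le_mul_right _ (by omega)
    rw [add_mul, one_mul] at h1
    omega
  rw [prod_split (fun t => j₀ + t * p) (fun m => m % p = j₀) hg hinj hsurj]
  -- the divisible part
  have hdivpart : ∏ t ∈ (range (N + 1)).erase J, (C (p : ℚ) * X + C (((j₀ + t * p : ℕ) : ℚ) - (j₀ + J * p : ℕ))) =
      C ((p : ℚ) ^ ((range (N + 1)).erase J).card) * ∏ t ∈ (range (N + 1)).erase J, (X + C ((t : ℚ) - J)) := by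
    rw [← prod_div_eq]
    refine prod_congr rfl fun t _ => ?_
    congr 2; push_cast; ring
  -- the unit part
  have hunit : ∀ m ∈ ((range (n₀ + N * p + 1)).erase (j₀ + J * p)).filter (fun m => ¬ m % p = j₀),
      Rat.padicValuation p ((m : ℚ) - (j₀ + J * p : ℕ)) = 1 := by
    intro m hm
    have hm' := (mem_filter.1 hm).2
    rw [show ((m : ℚ) - ((j₀ + J * p : ℕ) : ℚ)) = (((m : ℤ) - (j₀ + J * p : ℕ) : ℤ) : ℚ) by push_cast; ring]
    refine padicValuation_intCast_eq_one_of fun hdvd => hm' ?_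
    have h1 : ((j₀ + J * p : ℕ) : ℤ) % (p : ℤ) = (m : ℤ) % (p : ℤ) := Int.ModEq.eq (Int.modEq_iff_dvd.2 hdvd)
    rw [← Int.natCast_mod, ← Int.natCast_mod, Nat.cast_inj, hjmod] at h1
    exact h1.symm
  obtain ⟨V, hV, hc, hVeq⟩ := prod_unit_eq hunit
  refine ⟨V, hV, (p : ℚ) ^ ((range (N + 1)).erase J).card *
    ∏ m ∈ ((range (n₀ + N * p + 1)).erase (j₀ + J * p)).filter (fun m => ¬ m % p = j₀), ((m : ℚ) - (j₀ + J * p : ℕ)),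
    mul_ne_zero (pow_ne_zero _ (by exact_mod_cast hp.ne_zero)) hc, ?_⟩
  rw [hdivpart, hVeq, map_mul]
  ring

/-- NUMERATORS I (`x = −(j+m)`, `1 ≤ m ≤ n`): `∏_m(pX − (j+m)) = C(c)·[∏_{t=1}^{N}(X − (J+t))]·V` in the MAIN
CASE `n₀ + j₀ < p` (`j + m = p(J + t)` ↔ `m = tp − j₀`). -/
theorem num_family_one (h1 : n₀ + j₀ < p) (N J : ℕ) :
    ∃ V : ℚ[X], IsUnitPoly p V ∧ ∃ c : ℚ, c ≠ 0 ∧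
      ∏ m ∈ Icc 1 (n₀ + N * p), (C (p : ℚ) * X + C (-(((j₀ + J * p : ℕ) : ℚ) + m))) =
        C c * (∏ t ∈ Icc 1 N, (X + C (-((J : ℚ) + t)))) * V := by
  have hp : p.Prime := Fact.out
  have hp0 : 0 < p := hp.pos
  have hg : ∀ t ∈ Icc 1 N, t * p - j₀ ∈ Icc 1 (n₀ + N * p) ∧ p ∣ (j₀ + J * p) + (t * p - j₀) := by
    intro t ht
    have ht' := mem_Icc.1 ht
    have hlo : p ≤ t * p := Nat.le_mul_of_pos_left p (by omega)
    have hhi : t * p ≤ N * p := Nat.mul_le_mul_right _ ht'.2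
    refine ⟨mem_Icc.2 ⟨by omega, by omega⟩, ⟨J + t, ?_⟩⟩
    have : p * (J + t) = J * p + t * p := by ring
    omega
  have hinj : Set.InjOn (fun t => t * p - j₀) (Icc 1 N : Finset ℕ) := by
    intro t₁ ht₁ t₂ ht₂ h
    have h₁ : p ≤ t₁ * p := Nat.le_mul_of_pos_left p (by have := (mem_Icc.1 ht₁).1; omega)
    have h₂ : p ≤ t₂ * p := Nat.le_mul_of_pos_left p (by have := (mem_Icc.1 ht₂).1; omega)
    exact Nat.eq_of_mul_eq_mul_right hp0 (by simp only at h; omega)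
  have hsurj : ∀ m ∈ Icc 1 (n₀ + N * p), p ∣ (j₀ + J * p) + m → ∃ t ∈ Icc 1 N, t * p - j₀ = m := by
    intro m hm hdvd
    have hm' := mem_Icc.1 hm
    obtain ⟨q, hq⟩ := hdvd
    rw [mul_comm p q] at hq
    have hJq : J < q := by
      by_contra hcon
      have := Nat.mul_le_mul_right p (not_lt.1 hcon)
      omega
    have hqN : q ≤ J + N := by
      by_contra hcon
      have h2 := Nat.mul_le_mul_right p (show J + N + 1 ≤ q by omega)
      have h3 : (J + N + 1) * p = J * p + N * p + p := by ring
      omega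
    have hsub : (q - J) * p = q * p - J * p := Nat.sub_mul q J p
    refine ⟨q - J, mem_Icc.2 ⟨by omega, by omega⟩, ?_⟩
    show (q - J) * p - j₀ = m
    omega
  rw [prod_split (fun t => t * p - j₀) (fun m => p ∣ (j₀ + J * p) + m) hg hinj hsurj]
  have hdivpart : ∏ t ∈ Icc 1 N, (C (p : ℚ) * X + C (-(((j₀ + J * p : ℕ) : ℚ) + ((t * p - j₀ : ℕ) : ℚ)))) =
      C ((p : ℚ) ^ (Icc 1 N).card) * ∏ t ∈ Icc 1 N, (X + C (-((J : ℚ) + t))) := by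
    rw [← prod_div_eq]
    refine prod_congr rfl fun t ht => ?_
    have hlo : j₀ ≤ t * p := (Nat.le_mul_of_pos_left p (by have := (mem_Icc.1 ht).1; omega)).trans' (by omega)
    congr 2; push_cast [hlo]; ring
  have hunit : ∀ m ∈ (Icc 1 (n₀ + N * p)).filter (fun m => ¬ p ∣ (j₀ + J * p) + m),
      Rat.padicValuation p (-(((j₀ + J * p : ℕ) : ℚ) + m)) = 1 := by
    intro m hm
    rw [Valuation.map_neg, ← Nat.cast_add]
    exact padicValuation_natCast_eq_one (mem_filter.1 hm).2
  obtain ⟨V, hV, hc, hVeq⟩ := prod_unit_eq hunit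
  refine ⟨V, hV, _, mul_ne_zero (pow_ne_zero ((Icc 1 N).card) (by exact_mod_cast hp.ne_zero : (p : ℚ) ≠ 0)) hc, ?_⟩
  rw [hdivpart, hVeq, map_mul]
  ring

/-- NUMERATORS II (`x = n+m−j`, `1 ≤ m ≤ n`): `∏_m(pX + (n+m−j)) = C(c)·[∏_{t=1}^{N}(X + (N+t−J))]·V` in the MAIN
CASE `n₀ + (n₀ − j₀) < p`, `J ≤ N` (`n + m − j = p(N + t − J)` ↔ `m = tp − (n₀ − j₀)`). -/
theorem num_family_two (h2 : n₀ + (n₀ - j₀) < p) {N J : ℕ} (hJN : J ≤ N) :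
    ∃ V : ℚ[X], IsUnitPoly p V ∧ ∃ c : ℚ, c ≠ 0 ∧
      ∏ m ∈ Icc 1 (n₀ + N * p), (C (p : ℚ) * X + C (((n₀ + N * p : ℕ) : ℚ) + m - (j₀ + J * p : ℕ))) =
        C c * (∏ t ∈ Icc 1 N, (X + C ((N : ℚ) + t - J))) * V := by
  have hp : p.Prime := Fact.out
  have hp0 : 0 < p := hp.pos
  have hJp : J * p ≤ N * p := Nat.mul_le_mul_right _ hJN
  have hg : ∀ t ∈ Icc 1 N, t * p - (n₀ - j₀) ∈ Icc 1 (n₀ + N * p) ∧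
      p ∣ (n₀ + N * p) + (t * p - (n₀ - j₀)) - (j₀ + J * p) := by
    intro t ht
    have ht' := mem_Icc.1 ht
    have hlo : p ≤ t * p := Nat.le_mul_of_pos_left p (by omega)
    have hhi : t * p ≤ N * p := Nat.mul_le_mul_right _ ht'.2
    refine ⟨mem_Icc.2 ⟨by omega, by omega⟩, ⟨N + t - J, ?_⟩⟩
    have e1 : p * (N + t - J) = (N + t) * p - J * p := by rw [mul_comm, Nat.sub_mul]
    have e2 : (N + t) * p = N * p + t * p := by ring
    omega
  have hinj : Set.InjOn (fun t => t * p - (n₀ - j₀)) (Icc 1 N : Finset ℕ) := by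
    intro t₁ ht₁ t₂ ht₂ h
    have h₁ : p ≤ t₁ * p := Nat.le_mul_of_pos_left p (by have := (mem_Icc.1 ht₁).1; omega)
    have h₂ : p ≤ t₂ * p := Nat.le_mul_of_pos_left p (by have := (mem_Icc.1 ht₂).1; omega)
    exact Nat.eq_of_mul_eq_mul_right hp0 (by simp only at h; omega)
  have hsurj : ∀ m ∈ Icc 1 (n₀ + N * p), p ∣ (n₀ + N * p) + m - (j₀ + J * p) →
      ∃ t ∈ Icc 1 N, t * p - (n₀ - j₀) = m := by
    intro m hm hdvd
    have hm' := mem_Icc.1 hm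
    obtain ⟨q, hq⟩ := hdvd
    rw [mul_comm p q] at hq
    have hlo : N - J < q := by
      by_contra hcon
      have h3 := Nat.mul_le_mul_right p (not_lt.1 hcon)
      have h4 : (N - J) * p = N * p - J * p := Nat.sub_mul N J p
      omega
    have hhi : q ≤ 2 * N - J := by
      by_contra hcon
      have h3 := Nat.mul_le_mul_right p (show 2 * N - J + 1 ≤ q by omega)
      have h4 : (2 * N - J + 1) * p = 2 * (N * p) - J * p + p := by
        rw [add_mul, one_mul, Nat.sub_mul, mul_assoc]
      omega
    have hsub : (q - (N - J)) * p = q * p - (N * p - J * p) := by rw [Nat.sub_mul, Nat.sub_mul]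
    refine ⟨q - (N - J), mem_Icc.2 ⟨by omega, by omega⟩, ?_⟩
    show (q - (N - J)) * p - (n₀ - j₀) = m
    omega
  rw [prod_split (fun t => t * p - (n₀ - j₀)) (fun m => p ∣ (n₀ + N * p) + m - (j₀ + J * p)) hg hinj hsurj]
  have hdivpart : ∏ t ∈ Icc 1 N,
      (C (p : ℚ) * X + C (((n₀ + N * p : ℕ) : ℚ) + ((t * p - (n₀ - j₀) : ℕ) : ℚ) - (j₀ + J * p : ℕ))) =
      C ((p : ℚ) ^ (Icc 1 N).card) * ∏ t ∈ Icc 1 N, (X + C ((N : ℚ) + t - J)) := by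
    rw [← prod_div_eq]
    refine prod_congr rfl fun t ht => ?_
    have hlo : n₀ - j₀ ≤ t * p := (Nat.le_mul_of_pos_left p (by have := (mem_Icc.1 ht).1; omega)).trans' (by omega)
    congr 2; push_cast [hlo, hj₀]; ring
  have hunit : ∀ m ∈ (Icc 1 (n₀ + N * p)).filter (fun m => ¬ p ∣ (n₀ + N * p) + m - (j₀ + J * p)),
      Rat.padicValuation p (((n₀ + N * p : ℕ) : ℚ) + m - (j₀ + J * p : ℕ)) = 1 := by
    intro m hm
    have hle : j₀ + J * p ≤ n₀ + N * p + m := by omega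
    rw [← Nat.cast_add, ← Nat.cast_sub hle]
    exact padicValuation_natCast_eq_one (mem_filter.1 hm).2
  obtain ⟨V, hV, hc, hVeq⟩ := prod_unit_eq hunit
  refine ⟨V, hV, _, mul_ne_zero (pow_ne_zero ((Icc 1 N).card) (by exact_mod_cast hp.ne_zero : (p : ℚ) ≠ 0)) hc, ?_⟩
  rw [hdivpart, hVeq, map_mul]
  ring

omit hn₀ hj₀ in
/-- THE CENTRE FACTOR (`ε ≤ 1`): `(pX + (n/2 − j))^ε = C(c)·V`, `V` unit, `c ≠ 0`, provided `ε = 0` or `p ∤ n − 2j`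
(odd `p`). -/
theorem centre_factor (hp2 : p ≠ 2) {ε n j : ℕ} (hcen : ε = 0 ∨ ¬ (p : ℤ) ∣ (n : ℤ) - 2 * j) :
    ∃ V : ℚ[X], IsUnitPoly p V ∧ ∃ c : ℚ, c ≠ 0 ∧
      (C (p : ℚ) * X + C ((n : ℚ) / 2 - j)) ^ ε = C c * V := by
  have hp : p.Prime := Fact.out
  rcases hcen with hε | hndvd
  · exact ⟨1, isUnitPoly_one, 1, one_ne_zero, by rw [hε, pow_zero, map_one, mul_one]⟩
  · have hunit : Rat.padicValuation p ((n : ℚ) / 2 - j) = 1 := by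
      have htwo : Rat.padicValuation p (2 : ℚ) = 1 := by
        rw [show (2 : ℚ) = ((2 : ℤ) : ℚ) by norm_num]
        refine padicValuation_intCast_eq_one_of fun h => hp2 ?_
        exact (Nat.prime_dvd_prime_iff_eq hp Nat.prime_two).1 (by exact_mod_cast h)
      rw [show (n : ℚ) / 2 - j = (((n : ℤ) - 2 * j : ℤ) : ℚ) / 2 by push_cast; ring, map_div₀, htwo, div_one]
      exact padicValuation_intCast_eq_one_of hndvd
    have h0 : (n : ℚ) / 2 - j ≠ 0 := fun h => by rw [h, map_zero] at hunit; exact zero_ne_one hunit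
    refine ⟨(1 + C ((p : ℚ) / ((n : ℚ) / 2 - j)) * X) ^ ε, (isUnitPoly_factor hunit).pow ε,
      ((n : ℚ) / 2 - j) ^ ε, pow_ne_zero _ h0, ?_⟩
    rw [C_mul_X_add_C_eq h0, mul_pow, map_pow]

end families

end

end Summit.KontsevichZagierPeriods.Zeta5Search.BrickDigitStrip
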